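import Literature.NumberTheory.DiophantineApproximation.ViolaZudilinResidueIntegrals
import Mathlib.Data.Nat.Choose.Sum
import HarnessLib

/-!
# The inner residue in the `(ξ, η)` coordinates: invariance under `y = η/(η−z)`

Topic `Literature/NumberTheory/DiophantineApproximation`. DEFINITIONS (`pullback`, `resXZ`) with proved
API; no named facts.

Viola–Zudilin pass from Rhin–Viola's coordinates `(x, y)` to `(ξ, η)` by `x = ξ`, `y = η/(η−Z)` ((2.5));
the pole `y₀ = x/(x−z)` of `g(y) dy/(x(1−y)+yz)^{n+1}` corresponds to `η = ξ = x`, and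
`x(1−y)+yz = z(η−x)/(η−z)`, `dy = −z dη/(η−z)²`, so that
`g(y) dy/(x(1−y)+yz)^{n+1} = −z^{−n} · G(η) dη/((η−z)^{d+1−n}(η−x)^{n+1})`, `G(η) = (η−z)^d g(η/(η−z))`
(`d ≥ deg g`). The residue of a meromorphic 1-form does not depend on the coordinate; here this is
PROVED algebraically for the Hasse-derivative residues used in the tree:

* `pullback d z g = Σ_e g_e X^e (X−z)^{d−e}` (`= (η−z)^d g(η/(η−z))`, `pullback_eval`);
* `resXZ s a P x z = Σ_{i+i'=a−1} (D^{(i)}P)(x) · (−1)^{i'} binom(s+i'−1, i') (x−z)^{−s−i'}` = the residue at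
  `η = x` of `P(η) dη/((η−z)^s (η−x)^a)` (coefficient of `(η−x)^{a−1}` in `P(η)(η−z)^{−s}`);
* **`res₁_eq_resXZ`**: `res₁ z n g x = −z^{−n} · resXZ (d+1−n) (n+1) (pullback d z g) x z` for `x ≠ z`,
  `z ≠ 0`, `deg g, n ≤ d` — proved on the Taylor basis `(Y−y₀)^e` (both sides are linear in `g`;
  `pullback` of `(Y−y₀)^e` is `c^e (X−x)^e (X−z)^{d−e}`, `c = −z/(x−z)`, whose `resXZ` is `c^e δ_{e,n}/(x−z)`
  by the alternating binomial sum);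
* the Viola–Zudilin numerator: `pullback` of `Y^k(1−Y)^l(1−Y+zY)^N` is `(−1)^{l+N} z^{l+N} X^k (1−X)^N`, whence
  **`J₁_eq_integral_resXZ`**: `J_z^{(1)}(h,j,k,l,m,q) = (−1)^{l+N+1} ∫₀¹ ξ^j(1−ξ)^h · resXZ (l+q+1) (n+1) (X^k(1−X)^N) ξ z dξ`
  (`n = j+k−m`, `N = j+q−m`), i.e. VZ (2.11) with the `η`-residue at `η = ξ` written by Cauchy's formula.

## References

* C. Viola, W. Zudilin, J. reine angew. Math. 736 (2018) 193–223, (2.5), (2.11). [ViolaZudilin2018]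
* G. Rhin, C. Viola, Ann. Sc. Norm. Super. Pisa Cl. Sci. (5) 4 (2005) 389–437, (2.2), (2.5). [RhinViola2005]
-/

noncomputable section

namespace Literature.NumberTheory.DiophantineApproximation

namespace RhinViola

open Finset Polynomial
open _root_.MeasureTheory _root_.Set intervalIntegral

/-! ### The two functionals -/

/-- `pullback d z g = Σ_{e ≤ d} g_e · X^e (X − z)^{d−e}`, i.e. `(η−z)^d g(η/(η−z))` as a polynomial in `η`
(`d ≥ deg g`). [cite: ViolaZudilin2018, (2.5)] -/
def pullback (d : ℕ) (z : ℝ) (g : ℝ[X]) : ℝ[X] :=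
  ∑ e ∈ range (d + 1), g.coeff e • ((X : ℝ[X]) ^ e * (X - C z) ^ (d - e))

/-- The residue at `η = x` of `P(η) dη/((η−z)^s (η−x)^a)`: the coefficient of `(η−x)^{a−1}` in
`P(η)·(η−z)^{−s} = Σ_i (D^{(i)}P)(x)(η−x)^i · Σ_{i'} (−1)^{i'} binom(s+i'−1,i') (x−z)^{−s−i'} (η−x)^{i'}`.
[cite: ViolaZudilin2018, (2.11)] -/
def resXZ (s a : ℕ) (P : ℝ[X]) (x z : ℝ) : ℝ :=
  ∑ i ∈ range a, (hasseDeriv i P).eval x *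
    ((-1) ^ (a - 1 - i) * ((s + (a - 1 - i) - 1).choose (a - 1 - i) : ℝ) * (x - z) ^ (-((s : ℤ) + ((a - 1 - i : ℕ) : ℤ))))

/-- `pullback` evaluates to `(η−z)^d g(η/(η−z))` off `η = z`. [cite: ViolaZudilin2018, (2.5)] -/
theorem pullback_eval {d : ℕ} {g : ℝ[X]} (hg : g.natDegree ≤ d) (z : ℝ) {η : ℝ} (hη : η ≠ z) :
    (pullback d z g).eval η = (η - z) ^ d * g.eval (η / (η - z)) := by
  have hηz : η - z ≠ 0 := sub_ne_zero.2 hη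
  rw [pullback, eval_finsetSum, eval_eq_sum_range' (Nat.lt_succ_of_le hg), mul_sum]
  refine sum_congr rfl fun e he => ?_
  have hed : e ≤ d := Nat.lt_succ_iff.1 (mem_range.1 he)
  simp only [eval_smul, eval_mul, eval_pow, eval_X, eval_sub, eval_C, smul_eq_mul]
  rw [div_pow, pow_sub₀ _ hηz hed]
  field_simp

/-- `pullback` is additive. [folklore] -/
theorem pullback_add (d : ℕ) (z : ℝ) (g₁ g₂ : ℝ[X]) : pullback d z (g₁ + g₂) = pullback d z g₁ + pullback d z g₂ := by
  simp only [pullback, coeff_add, add_smul, sum_add_distrib]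

/-- `pullback` is homogeneous. [folklore] -/
theorem pullback_smul (d : ℕ) (z c : ℝ) (g : ℝ[X]) : pullback d z (c • g) = c • pullback d z g := by
  simp only [pullback, coeff_smul, smul_eq_mul, mul_smul, smul_sum]

/-- `pullback` of a finite linear combination. [folklore] -/
theorem pullback_sum {ι : Type*} (s : Finset ι) (d : ℕ) (z : ℝ) (c : ι → ℝ) (g : ι → ℝ[X]) :
    pullback d z (∑ i ∈ s, c i • g i) = ∑ i ∈ s, c i • pullback d z (g i) := by
  classical
  induction s using Finset.induction_on with
  | empty => simp [pullback]
  | insert a s ha ih => rw [sum_insert ha, sum_insert ha, pullback_add, pullback_smul, ih]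

/-- `resXZ` is additive in `P`. [folklore] -/
theorem resXZ_add (s a : ℕ) (P₁ P₂ : ℝ[X]) (x z : ℝ) : resXZ s a (P₁ + P₂) x z = resXZ s a P₁ x z + resXZ s a P₂ x z := by
  simp only [resXZ, map_add, eval_add, add_mul, sum_add_distrib]

/-- `resXZ` is homogeneous in `P`. [folklore] -/
theorem resXZ_smul (s a : ℕ) (c : ℝ) (P : ℝ[X]) (x z : ℝ) : resXZ s a (c • P) x z = c * resXZ s a P x z := by
  simp only [resXZ, map_smul, eval_smul, smul_eq_mul, mul_sum, mul_assoc]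

/-- `resXZ` of a finite linear combination. [folklore] -/
theorem resXZ_sum {ι : Type*} (t : Finset ι) (s a : ℕ) (c : ι → ℝ) (P : ι → ℝ[X]) (x z : ℝ) :
    resXZ s a (∑ i ∈ t, c i • P i) x z = ∑ i ∈ t, c i * resXZ s a (P i) x z := by
  classical
  induction t using Finset.induction_on with
  | empty => simp [resXZ]
  | insert b t hb ih => rw [sum_insert hb, sum_insert hb, resXZ_add, resXZ_smul, ih]

/-! ### The Taylor basis -/

/-- Taylor's formula as a finite sum of Hasse derivatives. [folklore] -/
theorem eq_sum_hasseDeriv_smul {g : ℝ[X]} {d : ℕ} (hg : g.natDegree ≤ d) (y₀ : ℝ) :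
    g = ∑ e ∈ range (d + 1), (hasseDeriv e g).eval y₀ • (X - C y₀) ^ e := by
  conv_lhs => rw [← sum_taylor_eq g y₀]
  rw [Polynomial.sum_over_range' _ (fun i => by simp) (d + 1) (by rw [natDegree_taylor]; omega)]
  refine sum_congr rfl fun e _ => ?_
  rw [taylor_coeff, smul_eq_C_mul]

/-- `D^{(n)}((Y−y₀)^e)(y₀) = δ_{e,n}`. [folklore] -/
theorem hasseDeriv_X_sub_C_pow_eval_self (n e : ℕ) (y₀ : ℝ) :
    (hasseDeriv n ((X - C y₀) ^ e)).eval y₀ = if e = n then 1 else 0 := by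
  rw [← taylor_coeff, taylor_pow, map_sub, taylor_X, taylor_C, add_sub_cancel_right, coeff_X_pow]
  simp only [eq_comm]

/-- `res₁` on the Taylor basis: `res₁ z n (Y−y₀)^e x = δ_{e,n}/(z−x)^{n+1}`, `y₀ = x/(x−z)`. [folklore] -/
theorem res₁_X_sub_C_pow (z : ℝ) (n e : ℕ) (x : ℝ) :
    res₁ z n ((X - C (x / (x - z))) ^ e) x = (if e = n then 1 else 0) / (z - x) ^ (n + 1) := by
  rw [res₁, hasseDeriv_X_sub_C_pow_eval_self]

/-- `pullback` on the Taylor basis: `(η−z)^d (η/(η−z) − x/(x−z))^e = c^e (η−x)^e (η−z)^{d−e}`,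
`c = −z/(x−z)`. [folklore] -/
theorem pullback_X_sub_C_pow {x z : ℝ} (hxz : x ≠ z) {d e : ℕ} (he : e ≤ d) :
    pullback d z ((X - C (x / (x - z))) ^ e) = C ((-z / (x - z)) ^ e) * (X - C x) ^ e * (X - C z) ^ (d - e) := by
  have hxz' : x - z ≠ 0 := sub_ne_zero.2 hxz
  apply Polynomial.eq_of_infinite_eval_eq
  refine Set.Infinite.mono (fun η (hη : η ∈ Set.Ioi z) => ?_) (Set.Ioi_infinite z)
  rw [Set.mem_setOf_eq]
  have hηz : η ≠ z := ne_of_gt hη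
  have hηz' : η - z ≠ 0 := sub_ne_zero.2 hηz
  have hdeg : ((X - C (x / (x - z))) ^ e).natDegree ≤ d :=
    natDegree_pow_le.trans (le_trans (Nat.mul_le_mul_left e (natDegree_X_sub_C_le _)) (by simpa using he))
  rw [pullback_eval hdeg z hηz]
  simp only [eval_mul, eval_pow, eval_sub, eval_X, eval_C]
  have key : η / (η - z) - x / (x - z) = (-z / (x - z)) * (η - x) / (η - z) := by
    field_simp; ring
  rw [key, div_pow, mul_pow, pow_sub₀ _ hηz' he]
  field_simp

/-- Hasse derivatives of the basis element `κ (X−x)^e (X−z)^{d−e}` at `x`. [folklore] -/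
theorem hasseDeriv_basis_eval (κ x z : ℝ) (d e i : ℕ) :
    (hasseDeriv i (C κ * (X - C x) ^ e * (X - C z) ^ (d - e))).eval x =
      if e ≤ i then κ * ((d - e).choose (i - e) : ℝ) * (x - z) ^ (d - e - (i - e)) else 0 := by
  rw [← taylor_coeff, taylor_mul, taylor_mul, taylor_C, taylor_pow, taylor_pow, map_sub, map_sub, taylor_X,
    taylor_C, taylor_C, add_sub_cancel_right, show (X + C x - C z : ℝ[X]) = X + C (x - z) by rw [map_sub]; ring,
    mul_assoc, coeff_C_mul, coeff_X_pow_mul', coeff_X_add_C_pow]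
  split_ifs <;> ring

/-- The alternating Vandermonde-type sum behind the basis computation:
`Σ_{i=e}^{n} (−1)^{n−i} binom(d−e, i−e) binom(d−i, n−i) = δ_{e,n}` (`e ≤ n ≤ d`). [folklore] -/
theorem sum_alternating_choose_mul_choose {e n d : ℕ} (hen : e ≤ n) (hnd : n ≤ d) :
    ∑ i ∈ Ico e (n + 1), ((-1 : ℝ) ^ (n - i) * ((d - e).choose (i - e) : ℝ) * ((d - i).choose (n - i) : ℝ)) =
      if e = n then 1 else 0 := by
  rw [sum_Ico_eq_sum_range, show n + 1 - e = (n - e) + 1 by omega]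
  have h1 : ∀ r ∈ range (n - e + 1), ((-1 : ℝ) ^ (n - (e + r)) * ((d - e).choose (e + r - e) : ℝ) *
      ((d - (e + r)).choose (n - (e + r)) : ℝ)) =
      ((d - e).choose (n - e) : ℝ) * ((-1 : ℝ) ^ (n - e - r) * ((n - e).choose r : ℝ)) := by
    intro r hr
    have hr' : r ≤ n - e := Nat.lt_succ_iff.1 (mem_range.1 hr)
    have hc := Nat.choose_mul (n := d - e) (k := n - e) (s := r) hr'
    rw [show e + r - e = r by omega, show d - (e + r) = d - e - r by omega, show n - (e + r) = n - e - r by omega]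
    have hc' : ((d - e).choose r : ℝ) * ((d - e - r).choose (n - e - r) : ℝ) =
        ((d - e).choose (n - e) : ℝ) * ((n - e).choose r : ℝ) := by exact_mod_cast hc.symm
    linear_combination ((-1 : ℝ) ^ (n - e - r)) * hc'
  rw [sum_congr rfl h1, ← mul_sum]
  -- the alternating sum `Σ_r (−1)^{N−r} binom(N, r) = δ_{N,0}`, `N = n − e`
  have h2 : ∀ N : ℕ, ∑ r ∈ range (N + 1), ((-1 : ℝ) ^ (N - r) * (N.choose r : ℝ)) = if N = 0 then 1 else 0 := by
    intro N
    have h3 : ∑ r ∈ range (N + 1), ((-1 : ℝ) ^ (N - r) * (N.choose r : ℝ)) =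
        ∑ r ∈ range (N + 1), ((-1 : ℝ) ^ r * (N.choose r : ℝ)) := by
      rw [← sum_range_reflect]
      refine sum_congr rfl fun r hr => ?_
      have hr' : r ≤ N := Nat.lt_succ_iff.1 (mem_range.1 hr)
      rw [show N + 1 - 1 - r = N - r by omega, show N - (N - r) = r by omega, Nat.choose_symm hr']
    rw [h3]
    have := Int.alternating_sum_range_choose (n := N)
    have h4 : (∑ r ∈ range (N + 1), ((-1 : ℝ) ^ r * (N.choose r : ℝ))) =
        ((∑ m ∈ range (N + 1), ((-1) ^ m * (N.choose m) : ℤ) : ℤ) : ℝ) := by push_cast; rfl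
    rw [h4, this]
    split_ifs <;> simp
  rw [h2 (n - e)]
  by_cases hen' : e = n
  · subst hen'; simp
  · rw [if_neg (by omega), if_neg hen', mul_zero]

/-- `resXZ` on the basis: `resXZ (d+1−n) (n+1) (κ (X−x)^e (X−z)^{d−e}) = κ δ_{e,n}/(x−z)` (`e, n ≤ d`, `x ≠ z`).
[folklore] -/
theorem resXZ_basis {x z : ℝ} (hxz : x ≠ z) (κ : ℝ) {d n : ℕ} (e : ℕ) (hn : n ≤ d) :
    resXZ (d + 1 - n) (n + 1) (C κ * (X - C x) ^ e * (X - C z) ^ (d - e)) x z =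
      κ * (x - z) ^ (-1 : ℤ) * (if e = n then 1 else 0) := by
  have hxz' : x - z ≠ 0 := sub_ne_zero.2 hxz
  have hterm : ∀ i ∈ range (n + 1),
      (hasseDeriv i (C κ * (X - C x) ^ e * (X - C z) ^ (d - e))).eval x *
        ((-1) ^ (n + 1 - 1 - i) * (((d + 1 - n) + (n + 1 - 1 - i) - 1).choose (n + 1 - 1 - i) : ℝ) *
          (x - z) ^ (-(((d + 1 - n : ℕ) : ℤ) + ((n + 1 - 1 - i : ℕ) : ℤ)))) =
      if e ≤ i then κ * (x - z) ^ (-1 : ℤ) *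
        ((-1 : ℝ) ^ (n - i) * ((d - e).choose (i - e) : ℝ) * ((d - i).choose (n - i) : ℝ)) else 0 := by
    intro i hi
    have hin : i ≤ n := Nat.lt_succ_iff.1 (mem_range.1 hi)
    rw [hasseDeriv_basis_eval]
    split_ifs with hei
    · rw [show n + 1 - 1 - i = n - i by omega, show d + 1 - n + (n - i) - 1 = d - i by omega,
        show d - e - (i - e) = d - i by omega]
      have hz1 : (x - z) ^ (d - i) * (x - z) ^ (-(((d + 1 - n : ℕ) : ℤ) + ((n - i : ℕ) : ℤ))) = (x - z) ^ (-1 : ℤ) := by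
        rw [← zpow_natCast, ← zpow_add₀ hxz']
        congr 1
        rw [Nat.cast_sub (hin.trans hn), Nat.cast_sub (by omega : n ≤ d + 1), Nat.cast_sub hin]
        push_cast
        ring
      calc κ * ((d - e).choose (i - e) : ℝ) * (x - z) ^ (d - i) *
            ((-1) ^ (n - i) * ((d - i).choose (n - i) : ℝ) * (x - z) ^ (-(((d + 1 - n : ℕ) : ℤ) + ((n - i : ℕ) : ℤ))))
          = κ * ((d - e).choose (i - e) : ℝ) * ((-1) ^ (n - i) * ((d - i).choose (n - i) : ℝ)) *
              ((x - z) ^ (d - i) * (x - z) ^ (-(((d + 1 - n : ℕ) : ℤ) + ((n - i : ℕ) : ℤ)))) := by ring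
        _ = _ := by rw [hz1]; ring
    · rw [zero_mul]
  rw [resXZ, sum_congr rfl hterm, ← sum_filter,
    show (range (n + 1)).filter (fun i => e ≤ i) = Finset.Ico e (n + 1) by
      ext i; simp only [Finset.mem_filter, Finset.mem_range, Finset.mem_Ico]; omega, ← mul_sum]
  by_cases hen : e ≤ n
  · rw [sum_alternating_choose_mul_choose hen hn]
  · rw [Finset.Ico_eq_empty (by omega), sum_empty, if_neg (by omega), mul_zero]

/-! ### The change of variables -/

/-- **Invariance of the residue under `y = η/(η−z)`**: for `x ≠ z`, `z ≠ 0` and `deg g, n ≤ d`,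
`res₁ z n g x = −z^{−n} · resXZ (d+1−n) (n+1) (pullback d z g) x z`. [cite: ViolaZudilin2018, (2.5) and (2.11)] -/
theorem res₁_eq_resXZ {x z : ℝ} (hxz : x ≠ z) (hz : z ≠ 0) {g : ℝ[X]} {d n : ℕ} (hg : g.natDegree ≤ d)
    (hn : n ≤ d) : res₁ z n g x = -(z⁻¹) ^ n * resXZ (d + 1 - n) (n + 1) (pullback d z g) x z := by
  have hxz' : x - z ≠ 0 := sub_ne_zero.2 hxz
  rw [eq_sum_hasseDeriv_smul hg (x / (x - z)), res₁_sum, pullback_sum, resXZ_sum, mul_sum]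
  refine sum_congr rfl fun e he => ?_
  have hed : e ≤ d := Nat.lt_succ_iff.1 (mem_range.1 he)
  rw [res₁_X_sub_C_pow, pullback_X_sub_C_pow hxz hed,
    show C ((-z / (x - z)) ^ e) * (X - C x) ^ e * (X - C z) ^ (d - e) =
      ((-z / (x - z)) ^ e) • ((C 1 * (X - C x) ^ e * (X - C z) ^ (d - e)) : ℝ[X]) by
      rw [smul_eq_C_mul, map_one, one_mul, mul_assoc],
    resXZ_smul, resXZ_basis hxz 1 e hn]
  by_cases hen : e = n
  · rw [if_pos hen, hen, zpow_neg_one,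
      show (-z / (x - z)) ^ n = (-1) ^ n * (z / (x - z)) ^ n by rw [neg_div, neg_pow],
      show (z - x) ^ (n + 1) = (-1) ^ n * (-1) * (x - z) ^ (n + 1) by rw [← neg_sub x z, neg_pow, pow_succ],
      div_pow, inv_pow]
    rcases neg_one_pow_eq_or ℝ n with h1 | h1 <;> rw [h1] <;> field_simp <;> ring
  · rw [if_neg hen]; simp

/-! ### The Viola–Zudilin numerator -/

/-- Degree of `Y^k(1−Y)^l(1−Y+zY)^N`. [folklore] -/
theorem natDegree_vz_numerator_le (z : ℝ) (k l N : ℕ) :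
    ((X : ℝ[X]) ^ k * (1 - X) ^ l * (1 - X + C z * X) ^ N).natDegree ≤ k + l + N := by
  have hX1 : (1 - X : ℝ[X]).natDegree ≤ 1 := (natDegree_sub_le _ _).trans (by simp)
  have h1 : ((1 - X : ℝ[X]) ^ l).natDegree ≤ l :=
    natDegree_pow_le.trans (by simpa using Nat.mul_le_mul_left l hX1)
  have h2 : ((1 - X + C z * X : ℝ[X]) ^ N).natDegree ≤ N := by
    refine natDegree_pow_le.trans ?_
    have : (1 - X + C z * X : ℝ[X]).natDegree ≤ 1 :=
      (natDegree_add_le _ _).trans (max_le ((natDegree_sub_le _ _).trans (by simp))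
        ((natDegree_C_mul_le _ _).trans natDegree_X_le))
    simpa using Nat.mul_le_mul_left N this
  refine natDegree_mul_le.trans (add_le_add (natDegree_mul_le.trans (add_le_add ?_ h1)) h2)
  exact natDegree_pow_le.trans (by simp)

/-- **The pulled-back Viola–Zudilin numerator**: `(η−z)^{k+l+N} · [y^k(1−y)^l(1−y+zy)^N]_{y=η/(η−z)} = (−1)^{l+N} z^{l+N} η^k (1−η)^N`
(`1−y = −z/(η−z)`, `1−y+zy = −z(1−η)/(η−z)`). [cite: ViolaZudilin2018, (2.5) and (2.9)] -/
theorem pullback_vz_numerator (z : ℝ) (k l N : ℕ) :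
    pullback (k + l + N) z ((X : ℝ[X]) ^ k * (1 - X) ^ l * (1 - X + C z * X) ^ N) =
      C ((-1) ^ (l + N) * z ^ (l + N)) * ((X : ℝ[X]) ^ k * (1 - X) ^ N) := by
  apply Polynomial.eq_of_infinite_eval_eq
  refine Set.Infinite.mono (fun η (hη : η ∈ Set.Ioi z) => ?_) (Set.Ioi_infinite z)
  rw [Set.mem_setOf_eq]
  have hηz : η ≠ z := ne_of_gt hη
  have hηz' : η - z ≠ 0 := sub_ne_zero.2 hηz
  rw [pullback_eval (natDegree_vz_numerator_le z k l N) z hηz]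
  simp only [eval_mul, eval_pow, eval_sub, eval_add, eval_one, eval_X, eval_C]
  have f1 : (η - z) * (η / (η - z)) = η := by field_simp
  have f2 : (η - z) * (1 - η / (η - z)) = -z := by field_simp; ring
  have f3 : (η - z) * (1 - η / (η - z) + z * (η / (η - z))) = -z * (1 - η) := by field_simp; ring
  calc (η - z) ^ (k + l + N) * ((η / (η - z)) ^ k * (1 - η / (η - z)) ^ l * (1 - η / (η - z) + z * (η / (η - z))) ^ N)
      = ((η - z) * (η / (η - z))) ^ k * ((η - z) * (1 - η / (η - z))) ^ l *
          ((η - z) * (1 - η / (η - z) + z * (η / (η - z)))) ^ N := by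
        rw [mul_pow, mul_pow, mul_pow, pow_add, pow_add]; ring
    _ = η ^ k * (-z) ^ l * (-z * (1 - η)) ^ N := by rw [f1, f2, f3]
    _ = _ := by rw [mul_pow, neg_pow z, neg_pow z, pow_add, pow_add]; ring

/-! ### `J_z^{(1)}` in the `(ξ, η)` coordinates -/

/-- **Viola–Zudilin (2.11) in Hasse form**: for `z > 1`, `m ≤ j+k`, `m ≤ j+q`, with `n = j+k−m`, `N = j+q−m`,
`J_z^{(1)}(h,j,k,l,m,q) = (−1)^{l+N+1} ∫₀¹ ξ^j(1−ξ)^h · resXZ (l+q+1) (n+1) (X^k(1−X)^N) ξ z dξ`, the inner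
factor being the residue at `η = ξ` of `η^k(1−η)^N dη/((η−z)^{l+q+1}(η−ξ)^{n+1})`.
[cite: ViolaZudilin2018, (2.11)] -/
theorem J₁_eq_integral_resXZ {z : ℝ} (hz : 1 < z) {j k m q : ℕ} (hm : m ≤ j + k) (hq : m ≤ j + q) (h l : ℕ) :
    ViolaZudilin.J₁ z h j k l m q = (-1) ^ (l + (j + q - m) + 1) *
      ∫ x in (0 : ℝ)..1, x ^ j * (1 - x) ^ h *
        resXZ (l + q + 1) (j + k - m + 1) ((X : ℝ[X]) ^ k * (1 - X) ^ (j + q - m)) x z := by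
  have hz0 : z ≠ 0 := by positivity
  rw [ViolaZudilin.J₁, if_pos hm, ← intervalIntegral.integral_const_mul, ← intervalIntegral.integral_const_mul]
  refine intervalIntegral.integral_congr fun x hx => ?_
  rw [Set.uIcc_of_le zero_le_one] at hx
  have hxz : x ≠ z := by intro hxz; rw [hxz] at hx; linarith [hx.2]
  rw [res₁_eq_resXZ hxz hz0 (natDegree_vz_numerator_le z k l (j + q - m)) (by omega : j + k - m ≤ k + l + (j + q - m)),
    pullback_vz_numerator, show k + l + (j + q - m) + 1 - (j + k - m) = l + q + 1 by omega,
    ← smul_eq_C_mul, resXZ_smul]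
  have hpow : z ^ ((k : ℤ) - l - q) * ((z⁻¹) ^ (j + k - m) * z ^ (l + (j + q - m))) = 1 := by
    rw [← zpow_natCast, ← zpow_natCast, inv_zpow', ← zpow_add₀ hz0, ← zpow_add₀ hz0, Nat.cast_sub hm,
      Nat.cast_add, Nat.cast_add, Nat.cast_sub hq]
    push_cast
    ring_nf
    exact zpow_zero z
  linear_combination (-(-1) ^ (l + (j + q - m)) * (x ^ j * (1 - x) ^ h *
    resXZ (l + q + 1) (j + k - m + 1) ((X : ℝ[X]) ^ k * (1 - X) ^ (j + q - m)) x z)) * hpow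

end RhinViola

end Literature.NumberTheory.DiophantineApproximation

end
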